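import Summits.CriticalPhenomena.PercolationContinuityZ3.Theorems.PercNearOneGluingNoHeavyLowerTailSahiCoSunflowerAtomCovering
import Mathlib.Tactic.Linarith
import Mathlib.Tactic.Ring
import Mathlib.Tactic.Positivity
import HarnessLib

/-!
# `NoHeavyLowerTail` (crux stmt-CriticalPhenomena-4575), master-family line P1 (gen 13):
# Sahi's `C₃` for every co-sunflower whose UNION IS AN OR-EVENT (generated by its singletons)

Support file (seat `prim-masterthm-p1`, gen 13; `--supports stmt-CriticalPhenomena-4575`).  No definitions, no `sorry`, standard axioms.
Generalises `coSunflower_nonneg_of_atomCovering` (same seat, `…SahiCoSunflowerAtomCovering`), reusing its vocabulary (`classPsi`,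
`avoid`, the atom groups `grpA/grpB/grpC`).  Memo `run/shared/lean/prim/prim-masterthm/FROM-prim-masterthm-p1-g13-CP3PLUS.md` §4.

**THEOREM (`coSunflower_nonneg_of_unionOr`).**  Let `G₁,G₂,G₃` be increasing events of the finite cube with a product weight and suppose the
union `G₁ ∪ G₂ ∪ G₃` is generated by singletons: every configuration in the union contains an atom `{u}` that is itself in the union
(equivalently `G₁ ∪ G₂ ∪ G₃ = {S : S ∩ R ≠ ∅}` is the OR-event of `R` = the set of such atoms; equivalently the outside "no `G_i` occurs"
is the full sub-cube `{S : S ∩ R = ∅}`; free coordinates outside `R` are allowed — `R = univ` is the atom-covering case).  Then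
`E₃(μ_p; 1_{G₂∪G₃}, 1_{G₁∪G₃}, 1_{G₁∪G₂}) ≥ Q₁Q₂Q₃(1−Q₁)(1−Q₂)(1−Q₃) ≥ 0`, `Q_i = ∏_{u ∈ P_i}(1−p_u)` over the atom groups (`P₁ ⊔ P₂ ⊔ P₃ = R`).
PROOF: as in the atom-covering case — a petal point (in `G_i` only) has all its `R`-atoms in `P_i`, so "only `G_i`" ⊆ `avoid(P_j ∪ P_k) ∖ avoid R`
(mass `Q_jQ_k − Q₁Q₂Q₃`), the outside is `avoid R` (mass `Q₁Q₂Q₃`), and the class functional is antitone in the petal masses at fixed outside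
mass (`classPsi_antitone`); the value at the envelope masses is the displayed product.  The envelope bound is sharp in the outside mass:
numerically it fails as soon as the outside is a proper sub-family of `avoid R`, so "union = OR-event" is exactly the reach of this argument.
[this work]
-/

noncomputable section

open scoped Classical

namespace Summit.CriticalPhenomena.PercolationContinuityZ3.Theorems

namespace SahiDeepCore

open Finset
open Literature.Combinatorics.Sahi2008
open Literature.Probability.Percolation.DecisionTree (ind ind_of_mem ind_of_not_mem ind_nonneg)

variable {ι : Type} [Fintype ι]

local notation3 (prettyPrint := false) "m⟦" p ", " X "⟧" => ex (bernoulliWeight p) (ind X)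

/-- `0 ≤ μ_p(X)` (plumbing). [folklore] -/
private theorem m_nn'' (p : ι → unitInterval) (X : Set (Set ι)) : 0 ≤ m⟦p, X⟧ :=
  ex_nonneg (isFKGMeasure_bernoulliWeight p).nonneg fun ω => ind_nonneg _ ω

/-- `μ_p(Y ∖ X) = μ_p(Y) − μ_p(X)` for `X ⊆ Y` (plumbing). [folklore] -/
private theorem m_sdiff'' (p : ι → unitInterval) {X Y : Set (Set ι)} (h : X ⊆ Y) : m⟦p, Y \ X⟧ = m⟦p, Y⟧ - m⟦p, X⟧ := by
  have e : ind Y = ind X + ind (Y \ X) := by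
    funext ω
    simp only [Pi.add_apply]
    by_cases hx : ω ∈ X
    · rw [ind_of_mem (h hx), ind_of_mem hx, ind_of_not_mem (fun hh : ω ∈ Y \ X => hh.2 hx), add_zero]
    · by_cases hy : ω ∈ Y
      · rw [ind_of_mem hy, ind_of_not_mem hx, ind_of_mem (show ω ∈ Y \ X from ⟨hy, hx⟩), zero_add]
      · rw [ind_of_not_mem hy, ind_of_not_mem hx, ind_of_not_mem (fun hh : ω ∈ Y \ X => hy hh.1), add_zero]
  have := congrArg (ex (bernoulliWeight p)) e
  rw [ex_add] at this
  linarith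

/-- Monotonicity of `μ_p` (plumbing). [folklore] -/
private theorem m_mono'' (p : ι → unitInterval) {X Y : Set (Set ι)} (h : X ⊆ Y) : m⟦p, X⟧ ≤ m⟦p, Y⟧ := by
  have := m_sdiff'' p h
  have h0 := m_nn'' p (Y \ X)
  linarith

/-- The atom groups are pairwise disjoint (no covering hypothesis needed). [this work] -/
theorem grp_disjoint (G₁ G₂ G₃ : Set (Set ι)) :
    Disjoint (grpA G₁) (grpB G₁ G₂) ∧ Disjoint (grpA G₁) (grpC G₁ G₂ G₃) ∧ Disjoint (grpB G₁ G₂) (grpC G₁ G₂ G₃) := by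
  have hm := mem_grp G₁ G₂ G₃
  refine ⟨?_, ?_, ?_⟩
  · exact Finset.disjoint_left.2 fun u ha hb => ((hm u).2.1.1 hb).2 ((hm u).1.1 ha)
  · exact Finset.disjoint_left.2 fun u ha hc => ((hm u).2.2.1 hc).2.1 ((hm u).1.1 ha)
  · exact Finset.disjoint_left.2 fun u hb hc => ((hm u).2.2.1 hc).2.2 ((hm u).2.1.1 hb).1

/-- An atom `{u}` lies in `G₁ ∪ G₂ ∪ G₃` iff `u` lies in one of the three atom groups. [this work] -/
theorem mem_grp_union_iff (G₁ G₂ G₃ : Set (Set ι)) (u : ι) :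
    u ∈ grpA G₁ ∪ grpB G₁ G₂ ∪ grpC G₁ G₂ G₃ ↔ ({u} : Set ι) ∈ G₁ ∪ G₂ ∪ G₃ := by
  have hm := mem_grp G₁ G₂ G₃ u
  simp only [Finset.mem_union, hm.1, hm.2.1, hm.2.2, Set.mem_union]
  constructor
  · rintro ((h | ⟨h, -⟩) | ⟨h, -, -⟩)
    · exact Or.inl (Or.inl h)
    · exact Or.inl (Or.inr h)
    · exact Or.inr h
  · intro h
    by_cases h1 : ({u} : Set ι) ∈ G₁
    · exact Or.inl (Or.inl h1)
    by_cases h2 : ({u} : Set ι) ∈ G₂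
    · exact Or.inl (Or.inr ⟨h2, h1⟩)
    rcases h with (h | h) | h
    · exact absurd h h1
    · exact absurd h h2
    · exact Or.inr ⟨h, h1, h2⟩

/-- **THEOREM (the class law when the union of the generators is an OR-event).**  If `G₁,G₂,G₃` are increasing and every configuration of
`G₁ ∪ G₂ ∪ G₃` contains an atom `{u} ∈ G₁ ∪ G₂ ∪ G₃`, then with `Q_i = ∏_{u ∈ P_i}(1 − p_u)` over the atom groups,
`E₃(μ_p; 1_{G₂∪G₃}, 1_{G₁∪G₃}, 1_{G₁∪G₂}) ≥ Q₁Q₂Q₃(1−Q₁)(1−Q₂)(1−Q₃)`. [this work] -/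
theorem coSunflower_ge_of_unionOr (p : ι → unitInterval) {G₁ G₂ G₃ : Set (Set ι)} (h₁ : IsUpperSet G₁) (h₂ : IsUpperSet G₂)
    (h₃ : IsUpperSet G₃) (hgen : ∀ S : Set ι, S ∈ G₁ ∪ G₂ ∪ G₃ → ∃ u ∈ S, ({u} : Set ι) ∈ G₁ ∪ G₂ ∪ G₃) :
    (∏ u ∈ grpA G₁, (1 - (p u : ℝ))) * (∏ u ∈ grpB G₁ G₂, (1 - (p u : ℝ))) * (∏ u ∈ grpC G₁ G₂ G₃, (1 - (p u : ℝ))) *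
        ((1 - ∏ u ∈ grpA G₁, (1 - (p u : ℝ))) * (1 - ∏ u ∈ grpB G₁ G₂, (1 - (p u : ℝ))) *
          (1 - ∏ u ∈ grpC G₁ G₂ G₃, (1 - (p u : ℝ)))) ≤
      sahiE (bernoulliWeight p) 3 ![ind (G₂ ∪ G₃), ind (G₁ ∪ G₃), ind (G₁ ∪ G₂)] := by
  obtain ⟨s1, s2, s3⟩ := coSunflower_sandwich G₁ G₂ G₃
  obtain ⟨e3, e2, e1⟩ := coSunflower_privateParts G₁ G₂ G₃
  obtain ⟨d01, d02, d12⟩ := grp_disjoint G₁ G₂ G₃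
  have hm := mem_grp G₁ G₂ G₃
  set P0 := grpA G₁
  set P1 := grpB G₁ G₂
  set P2 := grpC G₁ G₂ G₃
  set R := P0 ∪ P1 ∪ P2 with hRdef
  set Q0 := ∏ u ∈ P0, (1 - (p u : ℝ))
  set Q1 := ∏ u ∈ P1, (1 - (p u : ℝ))
  set Q2 := ∏ u ∈ P2, (1 - (p u : ℝ))
  -- outside = avoid R, of mass Q0 Q1 Q2
  have hout : ((G₂ ∪ G₃) ∪ (G₁ ∪ G₃))ᶜ = avoid R := by
    ext S
    simp only [Set.mem_compl_iff, mem_avoid]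
    constructor
    · intro hS u hu huS
      have hat : ({u} : Set ι) ∈ G₁ ∪ G₂ ∪ G₃ := (mem_grp_union_iff G₁ G₂ G₃ u).1 hu
      have hsub : ({u} : Set ι) ≤ S := Set.singleton_subset_iff.2 huS
      apply hS
      rcases hat with (h | h) | h
      · exact Or.inr (Or.inl (h₁ hsub h))
      · exact Or.inl (Or.inl (h₂ hsub h))
      · exact Or.inl (Or.inr (h₃ hsub h))
    · intro hS hU
      have hU' : S ∈ G₁ ∪ G₂ ∪ G₃ := by
        rcases hU with (h | h) | (h | h)
        · exact Or.inl (Or.inr h)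
        · exact Or.inr h
        · exact Or.inl (Or.inl h)
        · exact Or.inr h
      obtain ⟨u, huS, hat⟩ := hgen S hU'
      exact hS u ((mem_grp_union_iff G₁ G₂ G₃ u).2 hat) huS
  have hprodR : ∏ u ∈ R, (1 - (p u : ℝ)) = Q0 * Q1 * Q2 := by
    rw [hRdef, Finset.prod_union (Finset.disjoint_union_left.2 ⟨d02, d12⟩), Finset.prod_union d01]
  have ho : m⟦p, ((G₂ ∪ G₃) ∪ (G₁ ∪ G₃))ᶜ⟧ = Q0 * Q1 * Q2 := by rw [hout, m_avoid, hprodR]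
  -- petal points are in the union, hence not in the outside `avoid R`
  have notout : ∀ S : Set ι, S ∈ G₁ ∪ G₂ ∪ G₃ → S ∉ avoid R := by
    intro S hS hav
    have : S ∈ ((G₂ ∪ G₃) ∪ (G₁ ∪ G₃))ᶜ := by rw [hout]; exact hav
    apply this
    rcases hS with (h | h) | h
    · exact Or.inr (Or.inl h)
    · exact Or.inl (Or.inl h)
    · exact Or.inl (Or.inr h)
  have pet1 : (G₂ ∪ G₃) \ (G₁ ∪ G₃) ⊆ avoid (P0 ∪ P2) \ avoid R := by
    rw [e2]
    intro S hS
    have hS2 : S ∈ G₂ := hS.1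
    have hS1 : S ∉ G₁ := fun h => hS.2 (Or.inl h)
    have hS3 : S ∉ G₃ := fun h => hS.2 (Or.inr h)
    refine ⟨?_, notout S (Or.inl (Or.inr hS2))⟩
    intro u hu huS
    have hsub : ({u} : Set ι) ≤ S := Set.singleton_subset_iff.2 huS
    rcases Finset.mem_union.1 hu with h | h
    · exact hS1 (h₁ hsub ((hm u).1.1 h))
    · exact hS3 (h₃ hsub ((hm u).2.2.1 h).1)
  have pet2 : (G₁ ∪ G₃) \ (G₂ ∪ G₃) ⊆ avoid (P1 ∪ P2) \ avoid R := by
    rw [e1]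
    intro S hS
    have hS1 : S ∈ G₁ := hS.1
    have hS2 : S ∉ G₂ := fun h => hS.2 (Or.inl h)
    have hS3 : S ∉ G₃ := fun h => hS.2 (Or.inr h)
    refine ⟨?_, notout S (Or.inl (Or.inl hS1))⟩
    intro u hu huS
    have hsub : ({u} : Set ι) ≤ S := Set.singleton_subset_iff.2 huS
    rcases Finset.mem_union.1 hu with h | h
    · exact hS2 (h₂ hsub ((hm u).2.1.1 h).1)
    · exact hS3 (h₃ hsub ((hm u).2.2.1 h).1)
  have pet3 : ((G₂ ∪ G₃) ∩ (G₁ ∪ G₃)) \ (G₁ ∪ G₂) ⊆ avoid (P0 ∪ P1) \ avoid R := by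
    rw [e3]
    intro S hS
    have hS3 : S ∈ G₃ := hS.1
    have hS1 : S ∉ G₁ := fun h => hS.2 (Or.inl h)
    have hS2 : S ∉ G₂ := fun h => hS.2 (Or.inr h)
    refine ⟨?_, notout S (Or.inr hS3)⟩
    intro u hu huS
    have hsub : ({u} : Set ι) ≤ S := Set.singleton_subset_iff.2 huS
    rcases Finset.mem_union.1 hu with h | h
    · exact hS1 (h₁ hsub ((hm u).1.1 h))
    · exact hS2 (h₂ hsub ((hm u).2.1.1 h).1)
  have env : ∀ X : Finset ι, X ⊆ R → m⟦p, avoid X \ avoid R⟧ = (∏ u ∈ X, (1 - (p u : ℝ))) - Q0 * Q1 * Q2 := by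
    intro X hX; rw [m_sdiff'' p (avoid_mono hX), m_avoid, m_avoid, hprodR]
  have sub02 : P0 ∪ P2 ⊆ R := Finset.union_subset (Finset.subset_union_left.trans Finset.subset_union_left) Finset.subset_union_right
  have sub12 : P1 ∪ P2 ⊆ R := Finset.union_subset (Finset.subset_union_right.trans Finset.subset_union_left) Finset.subset_union_right
  have sub01 : P0 ∪ P1 ⊆ R := Finset.subset_union_left
  have hα : m⟦p, (G₂ ∪ G₃) \ (G₁ ∪ G₃)⟧ ≤ Q0 * Q2 - Q0 * Q1 * Q2 := by
    refine le_trans (m_mono'' p pet1) ?_; rw [env _ sub02, Finset.prod_union d02]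
  have hβ : m⟦p, (G₁ ∪ G₃) \ (G₂ ∪ G₃)⟧ ≤ Q1 * Q2 - Q0 * Q1 * Q2 := by
    refine le_trans (m_mono'' p pet2) ?_; rw [env _ sub12, Finset.prod_union d12]
  have hd : m⟦p, ((G₂ ∪ G₃) ∩ (G₁ ∪ G₃)) \ (G₁ ∪ G₂)⟧ ≤ Q0 * Q1 - Q0 * Q1 * Q2 := by
    refine le_trans (m_mono'' p pet3) ?_; rw [env _ sub01, Finset.prod_union d01]
  rw [sahiE_three_eq_classPsi p s1 s2 s3, ho]
  have key := classPsi_antitone (o := Q0 * Q1 * Q2) (mul_nonneg (mul_nonneg (prod_oneSub_mem p P0).1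
    (prod_oneSub_mem p P1).1) (prod_oneSub_mem p P2).1) (m_nn'' p _) (m_nn'' p _) (m_nn'' p _) hα hβ hd
  have val : classPsi (Q0 * Q1 * Q2) (Q0 * Q2 - Q0 * Q1 * Q2) (Q1 * Q2 - Q0 * Q1 * Q2)
      (Q0 * Q1 - Q0 * Q1 * Q2) = Q0 * Q1 * Q2 * ((1 - Q0) * (1 - Q1) * (1 - Q2)) := by
    unfold classPsi; ring
  linarith

/-- **COROLLARY (the class law on the "union = OR-event" stratum).**  Under the hypotheses of `coSunflower_ge_of_unionOr`,
`0 ≤ E₃(μ_p; 1_{G₂∪G₃}, 1_{G₁∪G₃}, 1_{G₁∪G₂})`; this contains `coSunflower_nonneg_of_atomCovering` (the case where every atom is in the union). [this work] -/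
theorem coSunflower_nonneg_of_unionOr (p : ι → unitInterval) {G₁ G₂ G₃ : Set (Set ι)} (h₁ : IsUpperSet G₁) (h₂ : IsUpperSet G₂)
    (h₃ : IsUpperSet G₃) (hgen : ∀ S : Set ι, S ∈ G₁ ∪ G₂ ∪ G₃ → ∃ u ∈ S, ({u} : Set ι) ∈ G₁ ∪ G₂ ∪ G₃) :
    0 ≤ sahiE (bernoulliWeight p) 3 ![ind (G₂ ∪ G₃), ind (G₁ ∪ G₃), ind (G₁ ∪ G₂)] := by
  refine le_trans ?_ (coSunflower_ge_of_unionOr p h₁ h₂ h₃ hgen)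
  have q0 := prod_oneSub_mem p (grpA G₁)
  have q1 := prod_oneSub_mem p (grpB G₁ G₂)
  have q2 := prod_oneSub_mem p (grpC G₁ G₂ G₃)
  exact mul_nonneg (mul_nonneg (mul_nonneg q0.1 q1.1) q2.1)
    (mul_nonneg (mul_nonneg (sub_nonneg.2 q0.2) (sub_nonneg.2 q1.2)) (sub_nonneg.2 q2.2))

end SahiDeepCore

end Summit.CriticalPhenomena.PercolationContinuityZ3.Theorems
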